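import Summits.CriticalPhenomena.Ising3DConformalLimit.Statement
import Summits.CriticalPhenomena.Ising3DConformalLimit.Theses.PositivityBegetsConformality
import Summits.CriticalPhenomena.Ising3DConformalLimit.Theses.HyperoctahedralRP
import Summits.CriticalPhenomena.Ising3DConformalLimit.Theorems.MonotoneBlockingLimitsAreConformalSummit
import Summits.CriticalPhenomena.Ising3DConformalLimit.Theorems.PerfectScreeningMoebiusLimitExistsInversionPositive
import Summits.CriticalPhenomena.Ising3DConformalLimit.Theorems.PositivityBegetsConformalityInversionPositiveLimitWitness
import HarnessLib

/-!
# Strategy census r1 for crux `InversionPositiveLimit` (stmt-CriticalPhenomena-4671): where the crux sits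

Kernel-checked placement of the crux `C := PositivityBegetsConformality.InversionPositiveLimit`
relative to the sub-problem `S := Ising3DConformalLimit` and to the hub items of route
`HyperoctahedralRP` (`E := ExistsScaleCovariantLimit` = stmt-1981, `U := InversionUpgradeNormalised`
= stmt-1982, `NG := IsingEuclidUpgradeR4NonGaussian` = stmt-0636), assembled from LANDED theorems only:

* `crux_iff_hub1982 : C ↔ U` (p141302) — the crux is item 1982 in the language of radial OS positivity;
* `summit_imp_crux : S → C` — the crux is a NECESSARY condition (a conjunct) of the sub-problem;
* `exists_of_crux_imp_summit : (C → S) → E` — ANY proof of `C → S` is a proof of existence (item 1981);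
* `crux_imp_summit_iff : (C → S) ↔ (E ∧ (U → NG))` — the exact price of `C → S`;
* `summit_iff_exists_and_crux_and_nonGaussian : S ↔ E' ∧ C ∧ NG'` — the route's own binders are a
  conjunct split of `S` (E', NG' the route's verbatim copies of E, NG);
so `C` is STRICTLY WEAKER than `S` modulo the open existence problem, and EQUIVALENT to hub 1982.
No `sorry`, no new definitions.
-/

namespace Summit.CriticalPhenomena.Ising3DConformalLimit.Cruxes.InversionPositiveLimit.StrategyCensusR1

open Summit.CriticalPhenomena.Ising3DConformalLimit.Theses
open Summit.CriticalPhenomena.Ising3DConformalLimit.Theorems.LimitsAreConformalSummit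
open Summit.CriticalPhenomena.Ising3DConformalLimit.MoebiusLimitExistsInversionPositive
open Summit.CriticalPhenomena.Ising3DConformalLimit.InversionPositiveLimitWitness

/-- The two spellings of item 1981 (route copies) are the same proposition. -/
theorem exists_pbc_iff_hrp :
    PositivityBegetsConformality.ExistsScaleCovariantLimit ↔ HyperoctahedralRP.ExistsScaleCovariantLimit :=
  Iff.rfl

/-- The two spellings of item 0636 (route copies) are the same proposition. -/
theorem nonGaussian_pbc_iff_hrp :
    PositivityBegetsConformality.IsingEuclidUpgradeR4NonGaussian ↔
      HyperoctahedralRP.IsingEuclidUpgradeR4NonGaussian :=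
  Iff.rfl

/-- **C ↔ hub 1982** (landed p141302, re-exported for the census). -/
theorem crux_iff_hub1982 :
    PositivityBegetsConformality.InversionPositiveLimit ↔ HyperoctahedralRP.InversionUpgradeNormalised :=
  inversionPositiveLimit_iff_inversionUpgradeNormalised

/-- **S → C**: the sub-problem implies the crux (chain `S → 1982 → C`). -/
theorem summit_imp_crux (h : _root_.Ising3DConformalLimit) :
    PositivityBegetsConformality.InversionPositiveLimit :=
  inversionPositiveLimit_of_inversionUpgradeNormalised (inversionUpgradeNormalised_of_summit h)

/-- **(C → S) → E**: any proof that the crux implies the sub-problem proves existence (item 1981)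
outright — because the crux holds vacuously without existence (`inversionPositiveLimit_of_not_exists`). -/
theorem exists_of_crux_imp_summit
    (h : PositivityBegetsConformality.InversionPositiveLimit → _root_.Ising3DConformalLimit) :
    HyperoctahedralRP.ExistsScaleCovariantLimit := by
  by_cases hE : PositivityBegetsConformality.ExistsScaleCovariantLimit
  · exact hE
  · exact existsScaleCovariantLimit_of_summit (h (inversionPositiveLimit_of_not_exists hE))

/-- **The exact price of `C → S`**: `(C → S) ↔ (E ∧ (U → NG))` — existence (1981) AND
"inversion upgrade ⟹ non-Gaussianity" (1982 → 0636). -/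
theorem crux_imp_summit_iff :
    (PositivityBegetsConformality.InversionPositiveLimit → _root_.Ising3DConformalLimit) ↔
      (HyperoctahedralRP.ExistsScaleCovariantLimit ∧
        (HyperoctahedralRP.InversionUpgradeNormalised → HyperoctahedralRP.IsingEuclidUpgradeR4NonGaussian)) := by
  constructor
  · intro h
    refine ⟨exists_of_crux_imp_summit h, fun hU => ?_⟩
    exact nonGaussian_of_summit (h (inversionPositiveLimit_of_inversionUpgradeNormalised hU))
  · rintro ⟨hE, hUNG⟩ hC
    have hU : HyperoctahedralRP.InversionUpgradeNormalised := crux_iff_hub1982.mp hC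
    exact summit_iff_three_hubs.mpr ⟨hE, hU, hUNG hU⟩

/-- **The route's binders are a conjunct split of S**: `S ↔ E' ∧ C ∧ NG'` with the route's own
copies `E'`, `NG'` of items 1981, 0636 (the support `MoebiusOfInversionPositive` being proved). -/
theorem summit_iff_exists_and_crux_and_nonGaussian :
    _root_.Ising3DConformalLimit ↔
      (PositivityBegetsConformality.ExistsScaleCovariantLimit ∧
        PositivityBegetsConformality.InversionPositiveLimit ∧
          PositivityBegetsConformality.IsingEuclidUpgradeR4NonGaussian) := by
  rw [crux_iff_hub1982]
  exact summit_iff_three_hubs.trans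
    (and_congr exists_pbc_iff_hrp.symm (and_congr Iff.rfl nonGaussian_pbc_iff_hrp.symm))

/-- **C is not S unless existence is a theorem**: `¬E → (C ∧ ¬S)` — in the absence of a
scale-covariant limit the crux holds and the sub-problem fails. -/
theorem crux_and_not_summit_of_not_exists (hE : ¬ HyperoctahedralRP.ExistsScaleCovariantLimit) :
    PositivityBegetsConformality.InversionPositiveLimit ∧ ¬ _root_.Ising3DConformalLimit :=
  ⟨inversionPositiveLimit_of_not_exists hE, fun hS => hE (existsScaleCovariantLimit_of_summit hS)⟩

end Summit.CriticalPhenomena.Ising3DConformalLimit.Cruxes.InversionPositiveLimit.StrategyCensusR1
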